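import Mathlib
import HarnessLib
import HarnessLib.Audit
import Summits.RiemannHypothesis.Statement
import HarnessLib.Audit.Status.Attr

/-!
Route: GroundBarta

# Route GroundBarta — Barta's floor for the FULL Weil ground state from Riemann's kernel Φ itself

FORWARD rung over the proved floor `OddSector.OddBartaFloor` (seed g1-RiemannHypothesis-17779): lift
the parity constraint. It suffices
to show (X) that beyond every height some window a carries a ground state of Weil's windowed
quadratic form Q(g) = W(g ⋆ g̃) on
ALL smooth tests supported in [−a, a] (no parity sector) that is real and ≥ 0 a.e. on the open
window (−a, a) — because RIEMANN'S
KERNEL ITSELF, Φ with Φ̂ = ξ, truncated to the window (the even theta vector K_a = Φ𝟙_[−a,a]) is a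
pointwise supersolution of the full
form with defect e(a) → 0 (crux GroundBartaFloor = the rung: one-signed bottom ⇒ ε(a) ≥ −e(a)), and
ε(a) ≥ −e(a) beyond every height
contradicts the uniform odd negativity an off-line zero forces (OddNegativityOffLine, proved). X is
filed REDIRECTED as the pair
PolarPerronFrobenius (Perron–Frobenius survives the rank-one polar term at some even-winning window
beyond every height) +
EvenWinsBeyondArch (the even sector carries the bottom; shared with route WeilParity).
Lean: `GroundBartaFloor → PolarPerronFrobenius → EvenWinsBeyondArch → OddNegativityOffLine →
Summit.RiemannHypothesis`

## Assembly
Pure logic (glue.lean `closes`, kernel-checked in Sketch.lean): assume ¬RH; OddNegativityOffLine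
gives η > 0 and A with a normalised
odd test of energy ≤ −η at every window a ≥ A; GroundBartaFloor gives e → 0 and a₀, hence A₁ beyond
which e(a) < η;
PolarPerronFrobenius gives a ≥ max(A, a₀, A₁, 1) at which even-winning ⇒ a one-signed ground state;
EvenWinsBeyondArch at a
(> (log 2)/2) supplies even-winning; so the floor applies: −e(a) ≤ Re Q(h) ≤ −η < −e(a),
contradiction. No Target item is filed (the Assembly item below is the
same implication the deciding theorem proves; it consumes all four items; X = PositiveGroundWindows
is the redirected pair #3 + #4).

Rationale: WHY THIS LINE. The floor's probe H_a = −Φ′𝟙 is odd and serves only the odd sector, where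
one-signedness of the bottom state fails at every resonant
window a = log q through an ORIGIN cusp (2001 §10; the parent's open crux OddOneSignedWindows). Its
even twin K_a = Φ𝟙 is positive,
even, and — since Φ̂(s) = ξ(s) vanishes at every nontrivial zero on or off the line
(weilMellin_weilThetaPhi, in the tree) — the
truncation of a GLOBAL NULL VECTOR of Weil's form: its window image is −2ϖ_a cosh(t/2) + Σ_n
Λ(n)n^(−1/2)(tail(t−log n)+tail(t+log n))
+ ∫ tail·w(|t−s|) with EVERY prime and archimedean term ≥ 0 (positive tail) and one wrong-signed
rank-one polar leakage of relative
size e(a) = 2ϖ_a cosh(a/2)/Φ(a) ≍ e^(−a); Barta's inequality [Bombieri2000Weil §4 Lemma 1 for the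
Euler–Lagrange identity; Barta 1937
via doi:10.1142/8664 p.175] then floors the FULL bottom ε(a), which Weil's criterion / the proved
odd negativity consume with no
Yoshida parity criterion and no origin cusp (even functions do not vanish at 0). Imported:
positivity-improving semigroups /
Krein–Rutman for the Markov part of the windowed explicit formula (MarkovPartPositiveGroundState,
route WeilGroundState, PROVED;
[Suzuki2026] Thm 1.4, §5.2) — in the even sector the ONLY non-Markov piece is the positive rank-one
pole term 2|⟨g, cosh(t/2)⟩|², so
the RH-bearing crux is a Perron–Frobenius PERSISTENCE statement for one rank-one perturbation
(Aronszajn–Krein resolvent formula,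
narrow-domain/boundary Hopf lemmas for nonlocal operators arXiv:1406.6181). No listed route uses Φ
itself as a window supersolution;
OddSector uses Φ′ (odd sector), WeilGroundState reaches RH through Connes–van Suijlekom real zeros +
û_a → ξ + Hurwitz
[ConnesSuijlekom2025, Connes2026Letter], WeilParity through off-line parity detection; negatives
index (2 entries) is in other families.

RANKED CRUXES. #2 GroundBartaFloor (crux) — THE RUNG (full-form Barta floor; the floor OddBartaFloor
with the parity constraint lifted — one hypothesis generalised): there are e → 0 and a₀ such that at
every window a ≥ a₀ carrying a ground state of the FULL windowed Weil form (L²-limit of an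
L²-normalised sequence of smooth window tests eventually below every normalised window test up to
any δ > 0) that is real and ≥ 0 a.e. on (−a, a), every L²-normalised smooth test supported in [−a,
a] has Re Q ≥ −e(a). Mechanism: the even theta vector K_a = Φ𝟙_[−a,a] (Φ̂ = ξ) is a pointwise
supersolution of the full form, T_a ≥ −e(a)K_a on (−a,a), and Barta's identity ε(a)⟨u, K_a⟩ = ⟨u,
T_a⟩ for the one-signed bottom u. Consequence of RH (e ≡ 0) but RH-free in substance; graded family
BartaFloorIn : Bool → Prop with BartaFloorIn true ≡ OddBartaFloor (proved, definitional
specialisation) and BartaFloorIn false ↔ this crux. [difficulty: M] (why it might fail: Needs the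
explicit formula for g ⋆ Φ̃ (super-exponentially decaying, not compactly supported) and the weak
Euler–Lagrange identity against a BV probe jumping at ±a for FULL minimising sequences; if the polar
leakage is not the only wrong-signed term of the image, no floor.) [Bombieri2000Weil, Suzuki2026,
doi:10.1142/8664, Literature.NumberTheory.LFunctions.weilMellin_weilThetaPhi,
Summit.RiemannHypothesis.RiemannHypothesis.Theorems.OddBartaFloor.OddBartaFloor_of]
#3 PolarPerronFrobenius (crux) — PERRON–FROBENIUS SURVIVES THE POLAR TERM, BEYOND EVERY HEIGHT: for
every A there is a window a ≥ A such that, IF the even sector carries the bottom at a (every odd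
normalised window test is matched up to any δ > 0 by an even one — the window-a clause of
EvenWinsBeyondArch), THEN some ground state of the full windowed form at a is real and ≥ 0 a.e. on
(−a, a). The Markov part of the form (−prime + archimedean) has a simple, even, strictly positive
ground state at EVERY window (MarkovPartPositiveGroundState, proved); in the even sector the only
perturbation is the positive rank-one pole term 2|⟨g, cosh(t/2)⟩|², and the even ground state is u ∝
(A₀ − ε)⁻¹cosh (Aronszajn–Krein). RH-bearing (with the rung and EvenWinsBeyondArch it decides RH);
the ∃-unbounded form dodges resonant windows a ≈ ½log n where edge layers of width ~e^(−a) can flip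
the sign. [deps: EvenWinsBeyondArch] [difficulty: XL] (why it might fail: Near the edge the ground
state is Φ(a)-small while polar leakage 2⟨c,u⟩cosh(t/2), the arithmetic spike Λ(⌈e^(2a)⌉)e^(−a)Φ(a)
and the log-singular archimedean pull compete at the same order (2001 §10 'holes'); under RH ≍x
near-null modes make 'the' bottom unstable.) [Suzuki2026, ConnesSuijlekom2025, Connes2026Letter,
ConnesConsaniMoscovici2025, arXiv:1406.6181, doi:10.1016/j.jfa.2004.02.005,
book:reednd-methods-modern-mathematical-physics-volume-iv-analysis]
#4 EvenWinsBeyondArch (crux) — route WeilParity's crux stmt-RiemannHypothesis-15432, RESTATED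
CONE-FREE in rev 1 (route-repair, cone): IsWeilTest g ↦ ContDiff ℝ ((⊤ : ℕ∞) : WithTop ℕ∞) g ∧
HasCompactSupport g and weilQuadratic ↦ the inline Q of items #2/#3/#9 (OddSector's cone-free
dictionary), DEFINITIONALLY EQUAL to WeilParity.EvenWinsBeyondArch (`example : _ ↔ _ := Iff.rfl`,
lean check rc 0, folder Defeq.lean; negative control DefeqNeg.lean fails as it should) — so it is
NOT to be attacked here: it closes by the one-line transport `:= h` from stmt-15432 (decomposed
there: OnePrimeWindowSimpleEven PROVED + NoParityCrossing open, split glue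
evenWinsBeyondArch_of_subs LANDED p148526). Content: on every window a > (log 2)/2 every odd
L²-normalised Weil test on [−a, a] is matched up to any δ > 0 by an even one (ε_ev(a) ≤ ε_od(a): the
even sector carries the bottom); here it discharges the hypothesis of PolarPerronFrobenius at the
windows beyond every height. [difficulty: open-problem] (why it might fail: RH-strength per
WeilParity (under ¬RH the parity order is expected to alternate past the visibility window); under
RH only Connes' prolate heuristic (even defect ≪ odd defect) and numerics (odd/even bottom ratio 57
→ 6000 on a ∈ [0.35, 1.2]) support it; a parity tie at one large window refutes it.)
[Bombieri2000Weil, Suzuki2026, ConnesSuijlekom2025, Connes2026Letter, ConnesConsani2023,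
Summit.RiemannHypothesis.RiemannHypothesis.Theorems.EvenWinsBeyondArch.evenWinsBeyondArch_of_subs]
#9 OddNegativityOffLine (support) — SHARED SUPPORT (route OddSector item
stmt-RiemannHypothesis-17780, PROVED: Theorems/OddSectorOddNegativityOffLine.lean
`oddNegativityOffLine_proof`; re-asked verbatim): Yoshida's odd criterion in contrapositive,
window-uniform — if RH fails there are η > 0 and A such that every window a ≥ A carries an
L²-normalised smooth ODD test h supported in [−a, a] with Re Q(h) ≤ −η. Used by `closes` as the
detector; an odd test is in particular a test, so the rung's floor applies to it. Statement
IDENTICAL to OddSector.OddNegativityOffLine (stmt-17780, closed proved): closes here by `:=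
Summit.RiemannHypothesis.RiemannHypothesis.Theorems.oddNegativityOffLine_proof` (defeq, one line;
open only because dedup does not attach to closed items). [difficulty: provable-now]
[Yoshida1992HermitianForms, Bombieri2000Weil]

TWO-LAYER PLAN. Once GroundBartaFloor lands (birth skeleton bc/GroundBartaFloor_birth.lean:
stub_groundBartaPairing [transport + Euler–Lagrange,
real form], stub_groundSupersolution [T_a ≥ −e(a)K_a], stub_groundPairingPos), split
PolarPerronFrobenius along its birth skeleton
(k = 2): EvenRealGroundState [RH-free existence of an even real ground state at an even-winning
window, CCM 2025 Thm 3.6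
compactness, in tree] → PolarPersistence [beyond every height, at an even-winning window every even
real ground state is one-signed]
→ PolarPerronFrobenius; and, after that, PolarPersistence ⇐ BulkThetaDominance (the even ground
state is L²/sup-close to
K_a/‖K_a‖ in the bulk) → EdgeHopf (narrow-domain maximum principle in the collars at non-resonant
windows). Nothing here is filed now.

KILL CRITERIA. (k1) GroundBartaFloor refuted — a window carrying a one-signed full ground state with
ε(a) below every admissible −e(a), or a proof
that the window image of Φ𝟙 has a wrong-signed term other than the polar leakage that is not o(Φ) on
the window — closes the route
`refuted:GroundBartaFloor` (the Φ-supersolution mechanism is dead; file the barrier note). (k2) A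
proof that at ALL large
even-winning windows every ground state changes sign (edge holes are generic, not resonant) refutes
PolarPerronFrobenius: pivot to
the ROBUST form (negative mass ∫(Re u)⁻(|T_a|+K_a) ≤ e′(a)∫Re u·K_a, as
Theorems/OddSectorOddOneSignedWindowsRobustBarta for the
odd sector) by `--restate`, or close `exhausted`. (k3) NoParityCrossing refuted (a parity tie beyond
(log 3)/2) breaks
EvenWinsBeyondArch in both routes: restate #3 unconditionally (drop the even-winning hypothesis) or
close. (k4) OddOneSignedWindows
(OddSector) or GroundStatesConvergeToXi (WeilGroundState) proved ⇒ RH closes there; this route is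
moot.

NOT DECOMPOSED YET. The supersolution decomposition of the window image of Φ𝟙 and the rate e(a)
(only e → 0 is filed); existence/regularity of full
ground states (CCM Thm 3.6 is in the tree; edge traces, the Euler–Lagrange identity of Bombieri's
Lemma 1 against BV probes); the
bulk/edge split of PolarPerronFrobenius and the Diophantine (non-resonant) window class; the robust
negative-mass form of the rung.
All are layer-2 children or `--supports` lemmas. No operator A_a and no theta vector are posited as
Lean objects in the items
(variational, operator-free encodings only; the skeleton defines groundThetaVector/…Image locally).

CHEAPEST FALSIFIER. For the rung: compute the window image of K_a = Φ𝟙 at ONE window (x = e^(2a) =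
5) term by term and check that prime and
archimedean layers are ≥ 0 and the polar leakage is ≤ e(a)Φ(t) with e(a) ≈ 2ϖ_a cosh(a/2)/Φ(a) — one
page plus a 30-digit
quadrature of ϖ_a = ∫_(s>a) Φ(s)·2cosh(s/2) ds. For PolarPerronFrobenius: one float Galerkin
diagonalisation of the EVEN block
(trig basis σ⁺ of arXiv:2106.01715 §2.2, N ≈ 150) at three non-resonant windows x ∈ [5, 27]
resolving the edge layer: a sign change of
the even ground state in the BULK at all three sends the route to (k2) within a day. Run here: the
F3 witness and all skeletons
elaborate (lean check rc 0); no numerics were run in this seat.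

NUMBERS. e(a) = 2ϖ_a cosh(a/2)/Φ(a) with ϖ_a = ∫_(s>a) Φ(s)2cosh(s/2)ds ≈ 2Φ(a)cosh(a/2)/(2πx), x =
e^(2a) ⇒ e(a) ≈ e^a/(πx) = e^(−a)/π
(odd floor: e₁(x) ~ (1+1/2π)(log x)/√x, 2001 Thm 4.1). Refuter data on this hub: odd/even bottom
ratio 57 → 640 on a ∈ [0.35, 0.7],
250 → ≈6000 on [0.55, 1.2] (Cruxes/GroundStateSimpleEven/Disproof.lean); ε_ev < ε_od certified on
(0, (log 3)/2]
(OnePrimeWindowSimpleEven, EvenWinsArch proved); Suzuki2026 Thm 1.4: for a ≤ a₀ the bottom is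
positive, simple, even, and the
limiting form is positivity improving (§5.2 p.14). Windowed Weil positivity known only near the
archimedean window
(weilPositivityOn_log_two_half_holds; Suzuki2026_thm_1_4_holds).

DEFINITION REQUESTS. None blocking. Conveniences: `IsWeilGroundStateJF a u` (the junk-free
∀h-eventually encoding of Literature's IsWeilGroundState,
parity-free twin of IsWeilOddGroundState; the items inline it) and `weilGroundThetaVector a =
Φ𝟙_[−a,a]` next to weilOddThetaVector in
Literature/NumberTheory/LFunctions/WeilOddThetaVector.lean. CONE NOTE (route-repair unit
rrepair-RiemannHypothesis-GroundBarta-692e102b, rev 1, 2026-08-17): needs-fact: NONE. The Phase-C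
guardrail flagged ONE unproved named fact in the MODULE cone,
Literature.NumberTheory.LFunctions.WeilPositivity — the @[conjecture] [status: open] statement of
Weil positivity, RH-EQUIVALENT in tree (weil_criterion_holds : RiemannHypothesis ↔ WeilPositivity,
WeilCriterionProofs.lean), so it can never be discharged short of the summit and must not be staffed
as tier-0 debt. No item and no line of `closes` names it (gate deps cone: 17 project constants, 0
unproved, staffable YES, tribunal passed); it rode in only on `import
Literature.NumberTheory.LFunctions.WeilExplicit`, needed solely for the vocabulary (IsWeilTest,
weilQuadratic) of crux #4, the other three items being already stated over Mathlib primitives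
(OddSector rev-1 dictionary: C g := MeasureTheory.convolution g (fun t => (starRingEnd ℂ) (g (-t)))
(ContinuousLinearMap.mul ℂ ℂ) volume = weilConv g (weilReflect g); M F s := ∫ t, F t * Complex.exp
((s - 1/2) * t) = weilMellin F s; Q := M (C g) 0 + M (C g) 1 − Σ' Λ(n) n^{−1/2} (C g (log n) + C g
(−log n)) + ((1/2π) ∫ M (C g) (1/2 + it) · Re ψ(1/4 + it/2) dt − C g 0 · log π) = weilQuadratic g).
Rev 1 therefore RESTATES #4 over Mathlib primitives (definitionally equal to WeilParity's
stmt-15432, Iff.rfl-certified) and DROPS the import: the route file imports nothing from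
Literature/, the module cone is Mathlib + HarnessLib + Summits.RiemannHypothesis.Statement,
conjecture-free — the same ruling as routes SignCone rev 3 and OddSector rev 1 (both staffed since),
whereas routes that kept the import with a note only (WeilParity, ShiftedResolvent) stayed
unstaffed. `closes` is unchanged (its term already fed the Literature-form #4 into the inline-form
hypothesis of #3 by unfolding); provers import WeilExplicit in their Theorems files and
`show`/`change` to the Literature vocabulary at will. Cost accepted: #4 is no longer ledger-shared
with stmt-15432 (dedup is by normalised signature), so when stmt-15432 closes a prover lands the
one-line transport here. Durable fix is operator-side (exempt @[conjecture] decls from the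
module-cone census, as the gate's deps cone already does, or move WeilPositivity with its
weil_criterion users into a leaf module); once it lands, `route edit --restate EvenWinsBeyondArch`
back to the Literature-vocabulary text (defeq, same decl name) re-attaches the shared item.

Novelty: Searches (2026-08-17): `lit search --hybrid "Barta inequality lower bound principal eigenvalue
positive supersolution nonlocal operator"` (10 book hits; relevant:
[corpus:book:lopez-gomez2012-linear-second-order-elliptic-operators p.175]
Barta/Protter–Weinberger/Donsker–Varadhan characterisation, requires a positive principal
eigenfunction); `lit galaxy search "Barta's inequality|Barta inequality" --star all` (1 hit, Kähler
Laplacian, unrelated); `lit galaxy search "Weil quadratic form|Weil's quadratic functional|Weil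
positivity" --star all` (5: Bombieri 2000 [galaxy:pdf:4005501466549090220], Suzuki CJM 2025 'On the
Hilbert space derived from the Weil distribution' [galaxy:pdf:4905270340] — de Branges model of the
Weil form under RH, no Barta/theta vector); `lit galaxy search "supersolution of the Weil|null
vector of Weil|annihilated by the Weil distribution|theta vector" --star all` (21 noise); `lit
vsearch` prose form (0 relevant); `lit search "Weil explicit formula … Riemann kernel theta
truncation Connes" --year-from 2019` (local: Suzuki2026 pp.3,13; remote: Connes–Consani
doi:10.1007/s00029-021-00689-4); `lit search "positivity improving nondegenerate ground state
strictly positive" --source local`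
([corpus:book:reednd-methods-modern-mathematical-physics-volume-iv-analysis p.195]); `lean search
--decl 'weilThetaVector|weilEvenThetaVector|groundTheta|BartaFloor'` (0; WeilOddThetaVector.lean's
docstring names the 2001 'even theta vector G_a = Φ𝟙' as NOT formalised); 23 ope  [refs: 10.1007/s00029-021-00689-4, 2606.09096, book:lopez-gomez2012-linear-second-order-elliptic-operators, doi:10.1007/s00029-021-00689-4, book:reednd-methods-modern-mathematical-physics-volume-iv-analysis, Suzuki2026, ConnesSuijlekom2025]

Barriers (technique_class: Weil-positivity, Barta-supersolution, ground-state-sign, PF): - technique_class: Weil-positivity, Barta-supersolution, ground-state-sign, Perron-Frobenius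
- Literature.Barriers.RiemannHypothesis.NewmanConjecture: consistent — Λ ≥ 0 forbids margins and
none is produced: the rung is a FLOOR −e(a) (wrong sign to be a margin) and ε(a) → 0⁺
super-exponentially under RH; PolarPerronFrobenius/EvenWinsBeyondArch are SIGN/ORDER statements,
scale-free. The bet is that sign structure, unlike margins, survives 'barely true'.
- Literature.Barriers.RiemannHypothesis.DeBrangesPositivity: not engaged — no positivity beyond
Weil's is asserted; the only unconditional inequality is the floor (RH-free by the odd twin's proof
pattern); Conrey–Li counterexamples concern de Branges' kernel conditions, which nothing here uses
(Suzuki's de Branges model [galaxy:pdf:4905270340] is not invoked).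
- Literature.Barriers.RiemannHypothesis.DavenportHeilbronn: evaded in kind — Λ(n) ≥ 0 enters as
positive jump RATES (Markov part) and as positive prime translates of the positive tail in the
supersolution inequality; for the Davenport–Heilbronn function the weights are signed, both the PF
structure and T_a ≥ −eK_a fail, so the argument cannot prove the false DH-RH.
- Literature.Barriers.RiemannHypothesis.RamanujanAxiomNecessity: not engaged — nothing is claimed
for a class of L-functions; every step uses ζ's own explicit formula and Riemann's kernel Φ.
- Literature.Barriers.RiemannHypothesis.BohrDenseValues: outside its class (the enumerator's token
overlap 'sector/positi

History (route lifecycle, newest last):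
- 2026-08-17T17:36:24Z · rev 1: restated EvenWinsBeyondArch (stmt-RiemannHypothesis-15432) — route-repair (cone, rrepair-RiemannHypothesis-GroundBarta-692e102b): rerouted — needs-fact: NONE. The only flagged module-cone fact, Literature.NumberTheory.LFu (planner-rrepair-RiemannHypothesis-GroundBarta-692e102b-0)

sub-problem: RiemannHypothesis · status: open · opened planner-fwd-rung-RiemannHypothesis-03-0 2026-08-17T15:11:36Z · rev 1 · ledger route-RiemannHypothesis-GroundBarta
GENERATED by the gate from the ledger (D-0016/17). Provers cite these decls: `theorem foo : Summit.RiemannHypothesis.RiemannHypothesis.Theses.GroundBarta.<Decl> := …` in Summits/RiemannHypothesis/RiemannHypothesis/Theorems/<Name>.lean.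
-/

namespace Summit.RiemannHypothesis.RiemannHypothesis.Theses.GroundBarta

open scoped BigOperators Topology Manifold Classical MeasureTheory ProbabilityTheory Matrix InnerProductSpace ComplexConjugate ContinuousMap
open Filter Set Function TopologicalSpace MeasureTheory

attribute [summit_statement] _root_.Summit.RiemannHypothesis

open Summit

/-- item stmt-RiemannHypothesis-18389 · crux · rank 2 · closed · proved by Summit.RiemannHypothesis.RiemannHypothesis.Theorems.GroundBartaFloor.GroundBartaFloor_of @ fdcf0d20aca5 (prover) · by planner
why it might fail: Needs the explicit formula for g ⋆ Φ̃ (super-exponentially decaying, not compactly supported) and the weak Euler–Lagrange identity against a BV probe jumping at ±a for FULL minimising sequences; if the polar leakage is not the only wrong-signed term of the image, no floor.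
sources: Bombieri2000Weil, Suzuki2026, doi:10.1142/8664, Literature.NumberTheory.LFunctions.weilMellin_weilThetaPhi, Summit.RiemannHypothesis.RiemannHypothesis.Theorems.OddBartaFloor.OddBartaFloor_of
[crux] THE RUNG (full-form Barta floor; the floor OddBartaFloor with the parity constraint lifted —
one hypothesis generalised): there are e → 0 and a₀ such that at every window a ≥ a₀ carrying a
ground state of the FULL windowed Weil form (L²-limit of an L²-normalised sequence of smooth window
tests eventually below every normalised window test up to any δ > 0) that is real and ≥ 0 a.e. on
(−a, a), every L²-normalised smooth test supported in [−a, a] has Re Q ≥ −e(a). Mechanism: the even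
theta vector K_a = Φ𝟙_[−a,a] (Φ̂ = ξ) is a pointwise supersolution of the full form, T_a ≥ −e(a)K_a
on (−a,a), and Barta's identity ε(a)⟨u, K_a⟩ = ⟨u, T_a⟩ for the one-signed bottom u. Consequence of
RH (e ≡ 0) but RH-free in substance; graded family BartaFloorIn : Bool → Prop with BartaFloorIn true
≡ OddBartaFloor (proved, definitional specialisation) and BartaFloorIn false ↔ this crux.
[difficulty: M] -/
@[route_item "route-RiemannHypothesis-GroundBarta", crux]
def GroundBartaFloor : Prop :=
  let C : (ℝ → ℂ) → ℝ → ℂ := fun g => MeasureTheory.convolution g (fun t => (starRingEnd ℂ) (g (-t))) (ContinuousLinearMap.mul ℂ ℂ) MeasureTheory.MeasureSpace.volume; let M : (ℝ → ℂ) → ℂ → ℂ := fun F s => ∫ t : ℝ, F t * Complex.exp ((s - 1 / 2) * t); let Q : (ℝ → ℂ) → ℂ := fun g => M (C g) 0 + M (C g) 1 - (∑' n : ℕ, ((ArithmeticFunction.vonMangoldt n : ℝ) : ℂ) / (Real.sqrt n : ℂ) * (C g (Real.log n) + C g (-Real.log n))) + ((1 / (2 * Real.pi) : ℂ) * (∫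 t : ℝ, M (C g) (1 / 2 + t * Complex.I) * ((Complex.digamma (1 / 4 + t / 2 * Complex.I)).re : ℂ)) - C g 0 * (Real.log Real.pi : ℂ)); ∃ e : ℝ → ℝ, Filter.Tendsto e Filter.atTop (nhds 0) ∧ ∃ a₀ : ℝ, ∀ a : ℝ, a₀ ≤ a → (∃ u : ℝ → ℂ, (MeasureTheory.MemLp u 2 ∧ ∃ g : ℕ → ℝ → ℂ, (∀ n, (ContDiff ℝ ((⊤ : ℕ∞) : WithTop ℕ∞) (g n) ∧ HasCompactSupport (g n)) ∧ tsupport (g n) ⊆ Set.Icc (-a) a ∧ ∫ t, ‖g n t‖ ^ 2 = (1 : ℝ)) ∧ (∀ h : ℝ → ℂ, (ContDiff ℝ ((⊤ : ℕ∞) : WithTop ℕ∞) h ∧ HasCompactSupport h) → tsupport h ⊆ Set.Icc (-a) a → ∫ t, ‖h t‖ ^ 2 = (1 : ℝ) → ∀ δ : ℝ, 0 < δ → ∀ᶠ n in Filter.atTop, (Q (g n)).re ≤ (Q h).re + δ) ∧ Filter.Tendsto (fun n => ∫ t, ‖g n t - u t‖ ^ 2) Filter.atTop (nhds 0)) ∧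 (∀ᵐ t : ℝ, t ∈ Set.Ioo (-a) a → (u t).im = 0 ∧ 0 ≤ (u t).re)) → ∀ h : ℝ → ℂ, (ContDiff ℝ ((⊤ : ℕ∞) : WithTop ℕ∞) h ∧ HasCompactSupport h) → tsupport h ⊆ Set.Icc (-a) a → ∫ t, ‖h t‖ ^ 2 = (1 : ℝ) → -e a ≤ (Q h).re

/-- item stmt-RiemannHypothesis-18390 · crux · rank 3 · open · by planner
why it might fail: Near the edge the ground state is Φ(a)-small while polar leakage 2⟨c,u⟩cosh(t/2), the arithmetic spike Λ(⌈e^(2a)⌉)e^(−a)Φ(a) and the log-singular archimedean pull compete at the same order (2001 §10 'holes'); under RH ≍x near-null modes make 'the' bottom unstable.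
sources: Suzuki2026, ConnesSuijlekom2025, Connes2026Letter, ConnesConsaniMoscovici2025, arXiv:1406.6181, doi:10.1016/j.jfa.2004.02.005
[crux] PERRON–FROBENIUS SURVIVES THE POLAR TERM, BEYOND EVERY HEIGHT: for every A there is a window
a ≥ A such that, IF the even sector carries the bottom at a (every odd normalised window test is
matched up to any δ > 0 by an even one — the window-a clause of EvenWinsBeyondArch), THEN some
ground state of the full windowed form at a is real and ≥ 0 a.e. on (−a, a). The Markov part of the
form (−prime + archimedean) has a simple, even, strictly positive ground state at EVERY window
(MarkovPartPositiveGroundState, proved); in the even sector the only perturbation is the positive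
rank-one pole term 2|⟨g, cosh(t/2)⟩|², and the even ground state is u ∝ (A₀ − ε)⁻¹cosh
(Aronszajn–Krein). RH-bearing (with the rung and EvenWinsBeyondArch it decides RH); the ∃-unbounded
form dodges resonant windows a ≈ ½log n where edge layers of width ~e^(−a) can flip the sign. [deps:
EvenWinsBeyondArch] [difficulty: XL] -/
@[route_item "route-RiemannHypothesis-GroundBarta", crux]
def PolarPerronFrobenius : Prop :=
  let C : (ℝ → ℂ) → ℝ → ℂ := fun g => MeasureTheory.convolution g (fun t => (starRingEnd ℂ) (g (-t))) (ContinuousLinearMap.mul ℂ ℂ) MeasureTheory.MeasureSpace.volume; let M : (ℝ → ℂ) → ℂ → ℂ := fun F s => ∫ t : ℝ, F t * Complex.exp ((s - 1 / 2) * t); let Q : (ℝ → ℂ) → ℂ := fun g => M (C g) 0 + M (C g) 1 - (∑' n : ℕ, ((ArithmeticFunction.vonMangoldt n : ℝ) : ℂ) / (Real.sqrt n : ℂ) * (C g (Real.log n) + C g (-Real.log n))) + ((1 / (2 * Real.pi) : ℂ) * (∫ t : ℝ, M (C g) (1 / 2 + t * Complex.I) * ((Complex.digamma (1 / 4 + t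 / 2 * Complex.I)).re : ℂ)) - C g 0 * (Real.log Real.pi : ℂ)); ∀ A : ℝ, ∃ a : ℝ, A ≤ a ∧ ((∀ o : ℝ → ℂ, (ContDiff ℝ ((⊤ : ℕ∞) : WithTop ℕ∞) o ∧ HasCompactSupport o) → tsupport o ⊆ Set.Icc (-a) a → (∀ t, o (-t) = -o t) → ∫ t, ‖o t‖ ^ 2 = (1 : ℝ) → ∀ δ : ℝ, 0 < δ → ∃ w : ℝ → ℂ, (ContDiff ℝ ((⊤ : ℕ∞) : WithTop ℕ∞) w ∧ HasCompactSupport w) ∧ tsupport w ⊆ Set.Icc (-a) a ∧ (∀ t, w (-t) = w t) ∧ ∫ t, ‖w t‖ ^ 2 = (1 : ℝ) ∧ (Q w).re ≤ (Q o).re + δ) → ∃ u : ℝ → ℂ, (MeasureTheory.MemLp u 2 ∧ ∃ g : ℕ → ℝ → ℂ, (∀ n, (ContDiff ℝ ((⊤ : ℕ∞) : WithTop ℕ∞) (g n) ∧ HasCompactSupport (g n)) ∧ tsupport (g n) ⊆ Set.Icc (-a) a ∧ ∫ t, ‖g n t‖ ^ 2 = (1 : ℝ)) ∧ (∀ h :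 ℝ → ℂ, (ContDiff ℝ ((⊤ : ℕ∞) : WithTop ℕ∞) h ∧ HasCompactSupport h) → tsupport h ⊆ Set.Icc (-a) a → ∫ t, ‖h t‖ ^ 2 = (1 : ℝ) → ∀ δ : ℝ, 0 < δ → ∀ᶠ n in Filter.atTop, (Q (g n)).re ≤ (Q h).re + δ) ∧ Filter.Tendsto (fun n => ∫ t, ‖g n t - u t‖ ^ 2) Filter.atTop (nhds 0)) ∧ (∀ᵐ t : ℝ, t ∈ Set.Ioo (-a) a → (u t).im = 0 ∧ 0 ≤ (u t).re))

-- earlier EvenWinsBeyondArch (stmt-RiemannHypothesis-15432, replaced 2026-08-17T17:36:24Z -> stmt-RiemannHypothesis-18807): open — ∀ a : ℝ, Real.log 2 / 2 < a → ∀ o : ℝ → ℂ, Literature.NumberTheory.LFunctions.IsWeilTest o → tsupport o ⊆ Set.Icc (-a) a → (∀ t, o (-t) = -o t) → ∫ t, ‖o t‖ ^ 2 = (1 : ℝ) → ∀ δ : ℝ, 0 < δ → ∃ e : ℝ → ℂ, Literature.NumberTheory.LFunctions.IsWeilTest e ∧ tsupport e ⊆ Set.I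
/-- item stmt-RiemannHypothesis-18807 · crux · rank 4 · open · by planner
why it might fail: RH-strength per WeilParity (under ¬RH the parity order is expected to alternate past the visibility window); under RH only Connes' prolate heuristic (even defect ≪ odd defect) and numerics (odd/even bottom ratio 57 → 6000 on a ∈ [0.35, 1.2]) support it; a parity tie at one large window refutes it.
sources: Bombieri2000Weil, Suzuki2026, ConnesSuijlekom2025, Connes2026Letter, ConnesConsani2023, Summit.RiemannHypothesis.RiemannHypothesis.Theorems.EvenWinsBeyondArch.evenWinsBeyondArch_of_subs
[crux] WeilParity's crux stmt-RiemannHypothesis-15432 RESTATED CONE-FREE (rev 1, route-repair cone;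
IsWeilTest ↦ ContDiff ℝ ∞ ∧ HasCompactSupport, weilQuadratic ↦ the inline Q — DEFINITIONALLY EQUAL
to WeilParity.EvenWinsBeyondArch, `Iff.rfl` certified): on every window a > (log 2)/2 (primes
present) every odd L²-normalised Weil test on [−a, a] is matched up to any δ > 0 by an even one (the
even sector carries the bottom). Do NOT attack it here: it closes by the one-line transport `:= h`
from stmt-15432, decomposed in route WeilParity as OnePrimeWindowSimpleEven (PROVED) +
NoParityCrossing (open, RH-bearing) with split glue evenWinsBeyondArch_of_subs LANDED. Here it
discharges the even-winning hypothesis of PolarPerronFrobenius at the windows beyond every height.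
[deps: WeilParity.NoParityCrossing] [difficulty: open-problem] -/
@[route_item "route-RiemannHypothesis-GroundBarta", crux]
def EvenWinsBeyondArch : Prop :=
  let C : (ℝ → ℂ) → ℝ → ℂ := fun g => MeasureTheory.convolution g (fun t => (starRingEnd ℂ) (g (-t))) (ContinuousLinearMap.mul ℂ ℂ) MeasureTheory.MeasureSpace.volume; let M : (ℝ → ℂ) → ℂ → ℂ := fun F s => ∫ t : ℝ, F t * Complex.exp ((s - 1 / 2) * t); let Q : (ℝ → ℂ) → ℂ := fun g => M (C g) 0 + M (C g) 1 - (∑' n : ℕ, ((ArithmeticFunction.vonMangoldt n : ℝ) : ℂ) / (Real.sqrt n : ℂ) * (C g (Real.log n) + C g (-Real.log n))) + ((1 / (2 * Real.pi) : ℂ) * (∫ t : ℝ, M (C g) (1 / 2 + t * Complex.I) * ((Complex.digamma (1 / 4 + t / 2 * Complex.I)).re : ℂ)) - C g 0 * (Real.log Real.pi : ℂ)); ∀ a : ℝ, Real.log 2 / 2 < a → ∀ o : ℝ → ℂ, (ContDiff ℝ ((⊤ : ℕ∞) : WithTop ℕ∞) o ∧ HasCompactSupport o) → tsupport o ⊆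 Set.Icc (-a) a → (∀ t, o (-t) = -o t) → ∫ t, ‖o t‖ ^ 2 = (1 : ℝ) → ∀ δ : ℝ, 0 < δ → ∃ e : ℝ → ℂ, (ContDiff ℝ ((⊤ : ℕ∞) : WithTop ℕ∞) e ∧ HasCompactSupport e) ∧ tsupport e ⊆ Set.Icc (-a) a ∧ (∀ t, e (-t) = e t) ∧ ∫ t, ‖e t‖ ^ 2 = (1 : ℝ) ∧ (Q e).re ≤ (Q o).re + δ

/-- item stmt-RiemannHypothesis-18391 · support · rank 9 · closed · proved by Summit.RiemannHypothesis.RiemannHypothesis.Theorems.GroundBarta.oddNegativityOffLine_proof @ 8aa70273b181 (prover) · by planner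
sources: Yoshida1992HermitianForms, Bombieri2000Weil
[support] SHARED SUPPORT (route OddSector item stmt-RiemannHypothesis-17780, PROVED:
Theorems/OddSectorOddNegativityOffLine.lean `oddNegativityOffLine_proof`; re-asked verbatim):
Yoshida's odd criterion in contrapositive, window-uniform — if RH fails there are η > 0 and A such
that every window a ≥ A carries an L²-normalised smooth ODD test h supported in [−a, a] with Re Q(h)
≤ −η. Used by `closes` as the detector; an odd test is in particular a test, so the rung's floor
applies to it. [difficulty: provable-now] -/
@[route_item "route-RiemannHypothesis-GroundBarta", crux]
def OddNegativityOffLine : Prop :=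
  let C : (ℝ → ℂ) → ℝ → ℂ := fun g => MeasureTheory.convolution g (fun t => (starRingEnd ℂ) (g (-t))) (ContinuousLinearMap.mul ℂ ℂ) MeasureTheory.MeasureSpace.volume; let M : (ℝ → ℂ) → ℂ → ℂ := fun F s => ∫ t : ℝ, F t * Complex.exp ((s - 1 / 2) * t); let Q : (ℝ → ℂ) → ℂ := fun g => M (C g) 0 + M (C g) 1 - (∑' n : ℕ, ((ArithmeticFunction.vonMangoldt n : ℝ) : ℂ) / (Real.sqrt n : ℂ) * (C g (Real.log n) + C g (-Real.log n))) + ((1 / (2 * Real.pi) : ℂ) * (∫ t : ℝ, M (C g) (1 / 2 + t * Complex.I) * ((Complex.digamma (1 / 4 + t / 2 * Complex.I)).re : ℂ)) - C g 0 * (Real.log Real.pi : ℂ)); ¬ RiemannHypothesis → ∃ η : ℝ, 0 < η ∧ ∃ A : ℝ, ∀ a : ℝ, A ≤ a → ∃ h : ℝ → ℂ, (ContDiff ℝ ((⊤ : ℕ∞) : WithTop ℕ∞) h ∧ HasCompactSupport h) ∧ tsupport h ⊆ Set.Icc (-a) a ∧ (∀ t, h (-t) = -h t) ∧ ∫ t,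 ‖h t‖ ^ 2 = (1 : ℝ) ∧ (Q h).re ≤ -η

/-- item stmt-RiemannHypothesis-18392 · assembly · rank 1 · closed · proved by Summit.RiemannHypothesis.RiemannHypothesis.Theorems.GroundBarta.assembly_proof @ 36c6c32241dc (prover) · by planner
sources: Bombieri2000Weil, Yoshida1992HermitianForms
[assembly] GroundBartaFloor → PolarPerronFrobenius → EvenWinsBeyondArch → OddNegativityOffLine →
RiemannHypothesis (by contradiction, as above; = glue.lean `closes`). -/
@[route_item "route-RiemannHypothesis-GroundBarta"]
def Assembly : Prop :=
  GroundBartaFloor → PolarPerronFrobenius → EvenWinsBeyondArch → OddNegativityOffLine → Summit.RiemannHypothesis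

/-! D-0027 §2.1 — DECIDING THEOREM (planner-authored via `route open/edit --closes-file`; by planner-rrepair-RiemannHypothesis-GroundBarta-692e102b-0 2026-08-17T17:36:24Z):
its hypotheses are this route's items and its conclusion the sub-problem Statement (glue_lint), and it elaborates with this file. -/

/-- DECIDING THEOREM (D-0027 §2.1) of route GroundBarta. By contradiction: if RH fails,
`OddNegativityOffLine` (Yoshida's odd criterion, contrapositive, window-uniform; PROVED in route OddSector)
gives `η > 0` and a height `A` beyond which every window carries a normalised odd test of energy `≤ -η`;
`GroundBartaFloor` (the rung) gives the floor `-e(a)`, `e → 0`, at windows carrying a one-signed ground state of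
the FULL form; `PolarPerronFrobenius` supplies, beyond the height `max A a₀ A₁ 1`, a window at which an even-winning
bottom forces such a ground state, and `EvenWinsBeyondArch` (rev 1: cone-free restatement, definitionally equal to route WeilParity's
`EvenWinsBeyondArch`, stmt-RiemannHypothesis-15432) says the even sector wins there (`a > (log 2)/2`). An odd test is a test, so `-e(a) ≤ Re Q(h) ≤ -η < -e(a)`: contradiction.
Axioms: propext, Classical.choice, Quot.sound. -/
@[closes "route-RiemannHypothesis-GroundBarta"] theorem closes (hFloor : GroundBartaFloor) (hPF : PolarPerronFrobenius)
    (hEven : EvenWinsBeyondArch) (hNeg : OddNegativityOffLine) : _root_.Summit.RiemannHypothesis := by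
  show _root_.RiemannHypothesis
  by_contra hRH
  obtain ⟨η, hη, A, hAneg⟩ := hNeg hRH
  obtain ⟨e, he, a₀, hfloor⟩ := hFloor
  have hev : ∀ᶠ a in Filter.atTop, e a < η := he.eventually (Iio_mem_nhds hη)
  obtain ⟨A₁, hA₁⟩ := Filter.eventually_atTop.1 hev
  obtain ⟨a, ha, hgood⟩ := hPF (max (max (max A a₀) A₁) 1)
  have haA : A ≤ a :=
    le_trans (le_trans (le_trans (le_max_left _ _) (le_max_left _ _)) (le_max_left _ _)) ha
  have ha₀ : a₀ ≤ a :=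
    le_trans (le_trans (le_trans (le_max_right _ _) (le_max_left _ _)) (le_max_left _ _)) ha
  have haA₁ : A₁ ≤ a := le_trans (le_trans (le_max_right _ _) (le_max_left _ _)) ha
  have ha1 : (1 : ℝ) ≤ a := le_trans (le_max_right _ _) ha
  have hlog : Real.log 2 / 2 < a := by
    have h2 : Real.log 2 < 0.6931471808 := Real.log_two_lt_d9
    linarith
  have hwin := hgood (hEven a hlog)
  obtain ⟨h, hh, hsupp, hodd, hnorm, hneg⟩ := hAneg a haA
  have h1 := hfloor a ha₀ hwin h hh hsupp hnorm
  have h2 : e a < η := hA₁ a haA₁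
  have h3 : -e a ≤ -η := le_trans h1 hneg
  linarith

end Summit.RiemannHypothesis.RiemannHypothesis.Theses.GroundBarta
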